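import Literature.NumberTheory.Transcendental.ZeroEstModel
import Literature.NumberTheory.Transcendental.GaGmZariski
import Literature.RingTheory.MvPolynomial.HomogeneousDimension
import Literature.RingTheory.KrullDimension.AffineCatenary
import Mathlib.RingTheory.Nullstellensatz
import Mathlib.Analysis.Complex.Polynomial.Basic
import Mathlib.RingTheory.Ideal.MinimalPrime.Noetherian
import Mathlib.RingTheory.KrullDimension.Polynomial
import HarnessLib

/-!
# Zero estimates on commutative algebraic groups, II: the Nullstellensatz on `G`, components, dimension

Topic `Literature/NumberTheory/Transcendental`. Second module of the discharge of
`Literature.NumberTheory.Transcendental.philippon1986_std` through D. Roy's exposition of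
Philippon's zero estimate (Nesterenko–Philippon (eds.), LNM 1752, Ch. 11), for an abstract
analytic group model `M : AnalyticGroupModel V N` (`ZeroEstModel.lean`). This is the projective
counterpart of the second half of `GaGmZariski.lean` (whose rôle of the torus unit `u` is played by
the boundary forms `M.bdry`; its generic lemmas `GaGm.ringKrullDim_poly`,
`GaGm.exists_ringKrullDim_quotient_eq` are reused):

* **Relevant primes** (`M.IsRelevant 𝔭`: some boundary form is not in `𝔭`) and the
  **Nullstellensatz on `G`** (`vanishing_zeroSet_eq_of_isPrime`): for a homogeneous prime
  `𝔭 ⊇ 𝔊` that is relevant, `𝔍(Z_G(𝔭)) = 𝔭`. Proof: Hilbert's Nullstellensatz in `ℂ^{N+1}`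
  (Mathlib `MvPolynomial.vanishingIdeal_zeroLocus_eq_radical`) produces a point of the affine cone
  `Z(𝔭)` off `Z(P·u)`; by the field `surj` it is `c·Θ(w)` with `c ≠ 0` (boundary forms have
  positive degree), and `w ∈ Z_G(𝔭)` with `F_P(w) ≠ 0`. Irrelevant primes have `Z_G = ∅`.
* `𝔍(X)` is saturated with respect to the boundary ideal (`mem_vanishing_of_forall_mul_bdry`),
  hence **its minimal primes are relevant** (`isRelevant_of_mem_minimalPrimes`), homogeneous and
  above `𝔊`; **components = minimal primes of `𝔍(X)`**: `isIrred_zeroSet_of_mem_minimalPrimes`,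
  `IsClosedG.eq_biUnion_minimalPrimes`, `IsIrred.exists_minimalPrimes_subset`,
  `eq_of_zeroSet_subset_of_mem_minimalPrimes`.
* **Dimension** `M.coneDim X ∈ ℕ`, the Krull dimension of `R ⧸ 𝔍(X)` (the dimension of the cone
  over `X`, i.e. `dim X + 1`; `0` for `∅`): `coneDim_le`, `coneDim_mono`, **strict decrease on
  proper closed subsets of an irreducible set** (`coneDim_lt_of_ssubset`), the dimension of a
  closed set is attained on a component (`exists_minimalPrimes_coneDim_eq`), an irreducible closed
  subset of `X` of dimension `coneDim X` is a component (`IsIrred.exists_eq_zeroSet_minimalPrimes`),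
  and the catenary bridge `coneDim Z_G(𝔭) + height 𝔭 = N + 1` for relevant homogeneous primes
  `𝔭 ⊇ 𝔊` (`coneDim_add_height`, from
  `Literature.RingTheory.KrullDimension.ringKrullDim_quotient_add_height`).

Everything is PROVED; `coneDim V = dim G + 1` (which uses the Jacobian fields) is in the sequel.

## References

* Yu. V. Nesterenko, P. Philippon (eds.), *Introduction to Algebraic Independence Theory*,
  LNM 1752, Springer 2001, Ch. 11 (D. Roy), §2.1–2.3. [NesterenkoPhilippon2001]
* H. Matsumura, *Commutative Ring Theory* (1986), Thm 5.6. [Matsumura1987]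
-/

noncomputable section

open MvPolynomial Set
open scoped Pointwise

namespace Literature.NumberTheory.Transcendental

namespace AnalyticGroupModel

variable {V : Type*} [NormedAddCommGroup V] [NormedSpace ℂ V] {N : ℕ} (M : AnalyticGroupModel V N)

attribute [local instance] MvPolynomial.gradedAlgebra

/-! ### Relevant primes and the Nullstellensatz on `G` -/

/-- An ideal is **relevant** (to `G = Ḡ ∖ Z(bdry)`) if some boundary form is not in it.
[cite: NesterenkoPhilippon2001, Ch. 11 Def. 2.1 (special ideals, Exercise)] -/
def IsRelevant (I : Ideal (MvPolynomial (Fin (N + 1)) ℂ)) : Prop := ∃ u ∈ M.bdry, u ∉ I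

/-- A form of positive degree vanishes at the origin. [folklore] -/
theorem eval_zero_of_isHomogeneous {u : MvPolynomial (Fin (N + 1)) ℂ} {d : ℕ} (hu : u.IsHomogeneous d)
    (hd : 0 < d) : eval (0 : Fin (N + 1) → ℂ) u = 0 := by
  have h := Literature.RingTheory.MvPolynomial.eval_smul_of_isHomogeneous hu (0 : ℂ)
    (0 : Fin (N + 1) → ℂ)
  rw [zero_smul, zero_pow hd.ne', zero_mul] at h
  exact h

/-- `𝔊 ⊆ 𝔭` for homogeneous `𝔭` means: every form killing `Θ(V)` lies in `𝔭`. [folklore] -/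
theorem mem_of_forall_F_eq_zero {𝔭 : Ideal (MvPolynomial (Fin (N + 1)) ℂ)} (h𝔊 : M.relIdeal ≤ 𝔭)
    {Q : MvPolynomial (Fin (N + 1)) ℂ} {d : ℕ} (hQ : Q.IsHomogeneous d)
    (h : ∀ w, eval (fun J => M.Θ J w) Q = 0) : Q ∈ 𝔭 :=
  h𝔊 ((M.mem_relIdeal_iff_of_isHomogeneous hQ).mpr h)

/-- **The Nullstellensatz on `G`, point form.** For a homogeneous prime `𝔭 ⊇ 𝔊`, a boundary form
`u ∉ 𝔭` and a form `P ∉ 𝔭`, there is a point of `Z_G(𝔭)` where `F_P F_u ≠ 0`.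
[cite: NesterenkoPhilippon2001, Ch. 11 §2.3] -/
theorem exists_mem_zeroSet_F_ne_zero {𝔭 : Ideal (MvPolynomial (Fin (N + 1)) ℂ)} [h𝔭 : 𝔭.IsPrime]
    (hhom : 𝔭.IsHomogeneous (homogeneousSubmodule (Fin (N + 1)) ℂ)) (h𝔊 : M.relIdeal ≤ 𝔭)
    {u : MvPolynomial (Fin (N + 1)) ℂ} (hu : u ∈ M.bdry) (hu𝔭 : u ∉ 𝔭)
    {P : MvPolynomial (Fin (N + 1)) ℂ} {d : ℕ} (hP : P.IsHomogeneous d) (hP𝔭 : P ∉ 𝔭) :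
    ∃ w, w ∈ M.zeroSet (𝔭 : Set (MvPolynomial (Fin (N + 1)) ℂ)) ∧ M.F P w ≠ 0 ∧ M.F u w ≠ 0 := by
  have hPu : P * u ∉ 𝔭 := fun h => (h𝔭.mem_or_mem h).elim hP𝔭 hu𝔭
  -- a point of the affine cone `Z(𝔭) ⊆ ℂ^{N+1}` where `P u ≠ 0`
  have hrad := MvPolynomial.IsPrime.vanishingIdeal_zeroLocus (k := ℂ) (K := ℂ) 𝔭
  have hnot : P * u ∉ MvPolynomial.vanishingIdeal ℂ (MvPolynomial.zeroLocus ℂ 𝔭) := by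
    rwa [hrad]
  simp only [MvPolynomial.mem_vanishingIdeal_iff, not_forall] at hnot
  obtain ⟨x, hx, hPux⟩ := hnot
  rw [MvPolynomial.mem_zeroLocus_iff] at hx
  -- `aeval = eval` here
  have hx' : ∀ p ∈ 𝔭, eval x p = 0 := hx
  have hPux' : eval x (P * u) ≠ 0 := hPux
  clear hx hPux
  obtain ⟨du, hdu, hudu⟩ := M.isHomogeneous_bdry u hu
  -- `x = c Θ(w)`
  obtain ⟨c, w, rfl⟩ := M.surj x (fun Q e hQ hQ0 => hx' Q (M.mem_of_forall_F_eq_zero h𝔊 hQ hQ0))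
    ⟨u, hu, fun h => hPux' (by rw [map_mul, h, mul_zero])⟩
  have hc : c ≠ 0 := by
    rintro rfl
    apply hPux'
    rw [zero_smul, map_mul, eval_zero_of_isHomogeneous hudu hdu, mul_zero]
  rw [map_mul, show (c • fun J => M.Θ J w) = c • M.pt w from rfl,
    M.eval_smul_pt hP, M.eval_smul_pt hudu] at hPux'
  refine ⟨w, fun Q hQ c' => ?_, fun h => hPux' (by rw [h]; ring), fun h => hPux' (by rw [h]; ring)⟩
  -- every homogeneous component of `Q ∈ 𝔭` vanishes at `Θ(w)`
  rw [← sum_homogeneousComponent Q, map_sum]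
  refine Finset.sum_eq_zero fun e _ => ?_
  have hQe : homogeneousComponent e Q ∈ 𝔭 := homogeneousComponent_mem_of_mem hhom hQ e
  have h1 := hx' _ hQe
  rw [show (c • fun J => M.Θ J w) = c • M.pt w from rfl,
    M.eval_smul_pt (homogeneousComponent_isHomogeneous e Q)] at h1
  rw [M.eval_smul_pt (homogeneousComponent_isHomogeneous e Q),
    (mul_eq_zero.mp h1).resolve_left (pow_ne_zero _ hc), mul_zero]

/-- **The Nullstellensatz on `G`**: for a relevant homogeneous prime `𝔭 ⊇ 𝔊`,
`𝔍(Z_G(𝔭)) = 𝔭`. [cite: NesterenkoPhilippon2001, Ch. 11 §2.3 (special prime ideals)] -/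
theorem vanishing_zeroSet_eq_of_isPrime {𝔭 : Ideal (MvPolynomial (Fin (N + 1)) ℂ)} [𝔭.IsPrime]
    (hhom : 𝔭.IsHomogeneous (homogeneousSubmodule (Fin (N + 1)) ℂ)) (h𝔊 : M.relIdeal ≤ 𝔭)
    (hrel : M.IsRelevant 𝔭) : M.vanishing (M.zeroSet (𝔭 : Set (MvPolynomial (Fin (N + 1)) ℂ))) = 𝔭 := by
  refine le_antisymm (fun Q hQ => ?_) (M.subset_vanishing_zeroSet _)
  obtain ⟨u, hu, hu𝔭⟩ := hrel
  rw [mem_iff_homogeneousComponent_mem hhom]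
  intro e
  by_contra hQe
  obtain ⟨w, hw, hF, -⟩ := M.exists_mem_zeroSet_F_ne_zero hhom h𝔊 hu hu𝔭
    (homogeneousComponent_isHomogeneous e Q) hQe
  exact hF ((M.mem_vanishing_iff_of_isHomogeneous (homogeneousComponent_isHomogeneous e Q)).mp
    (M.homogeneousComponent_mem_vanishing hQ e) w hw)

/-- A relevant homogeneous prime above `𝔊` has a zero in `G`. [folklore] -/
theorem zeroSet_nonempty_of_isRelevant {𝔭 : Ideal (MvPolynomial (Fin (N + 1)) ℂ)} [𝔭.IsPrime]
    (hhom : 𝔭.IsHomogeneous (homogeneousSubmodule (Fin (N + 1)) ℂ)) (h𝔊 : M.relIdeal ≤ 𝔭)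
    (hrel : M.IsRelevant 𝔭) : (M.zeroSet (𝔭 : Set (MvPolynomial (Fin (N + 1)) ℂ))).Nonempty := by
  obtain ⟨u, hu, hu𝔭⟩ := hrel
  obtain ⟨w, hw, -⟩ := M.exists_mem_zeroSet_F_ne_zero hhom h𝔊 hu hu𝔭 (isHomogeneous_one _ _)
    (Ideal.IsPrime.ne_top inferInstance |> fun h h1 => h ((Ideal.eq_top_iff_one _).mpr h1))
  exact ⟨w, hw⟩

/-- An irrelevant ideal has no zero in `G`. [folklore] -/
theorem zeroSet_eq_empty_of_not_isRelevant {I : Ideal (MvPolynomial (Fin (N + 1)) ℂ)}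
    (h : ¬ M.IsRelevant I) : M.zeroSet (I : Set (MvPolynomial (Fin (N + 1)) ℂ)) = ∅ := by
  simp only [IsRelevant, not_exists, not_and, not_not] at h
  ext w
  simp only [mem_empty_iff_false, iff_false]
  intro hw
  obtain ⟨u, hu, hne⟩ := M.exists_bdry_ne_zero w
  have := hw u (h u hu) 1
  rw [one_smul] at this
  exact hne this

/-- The vanishing ideal of a non-empty set is relevant. [folklore] -/
theorem isRelevant_vanishing {X : Set V} (hX : X.Nonempty) : M.IsRelevant (M.vanishing X) := by
  obtain ⟨w, hw⟩ := hX
  obtain ⟨u, hu, hne⟩ := M.exists_bdry_ne_zero w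
  refine ⟨u, hu, fun h => hne ?_⟩
  have := h w hw 1
  rwa [one_smul] at this

/-- The vanishing ideal of a non-empty set is proper. [folklore] -/
theorem vanishing_ne_top {X : Set V} (hX : X.Nonempty) : M.vanishing X ≠ ⊤ := by
  obtain ⟨u, -, hu⟩ := M.isRelevant_vanishing hX
  exact fun h => hu (h ▸ Submodule.mem_top)

/-! ### Saturation by the boundary and minimal primes -/

/-- A continuous function on `ℂ` vanishing off the origin vanishes at the origin. [folklore] -/
theorem eq_zero_of_forall_ne_zero {f : ℂ → ℂ} (hf : Continuous f) (h : ∀ c ≠ 0, f c = 0) : f 0 = 0 := by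
  have hcl : IsClosed {c : ℂ | f c = 0} := isClosed_eq hf continuous_const
  have hsub : ({0}ᶜ : Set ℂ) ⊆ {c : ℂ | f c = 0} := fun c hc => h c hc
  have hdense : Dense ({0}ᶜ : Set ℂ) := dense_compl_singleton 0
  have : (univ : Set ℂ) ⊆ {c : ℂ | f c = 0} := by
    rw [← hdense.closure_eq]
    exact hcl.closure_subset_iff.mpr hsub
  exact this (mem_univ 0)

/-- **`𝔍(X)` is saturated with respect to the boundary ideal**: if `P u ∈ 𝔍(X)` for every
boundary form `u` then `P ∈ 𝔍(X)`. [folklore] -/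
theorem mem_vanishing_of_forall_mul_bdry {X : Set V} {P : MvPolynomial (Fin (N + 1)) ℂ}
    (h : ∀ u ∈ M.bdry, P * u ∈ M.vanishing X) : P ∈ M.vanishing X := by
  intro w hw
  obtain ⟨u, hu, hne⟩ := M.exists_bdry_ne_zero w
  obtain ⟨e, -, hue⟩ := M.isHomogeneous_bdry u hu
  have hne' : M.F u w ≠ 0 := hne
  have hc : ∀ c : ℂ, c ≠ 0 → eval (c • M.pt w) P = 0 := by
    intro c hc
    have := h u hu w hw c
    rw [map_mul, M.eval_smul_pt hue] at this
    exact (mul_eq_zero.mp this).resolve_right (mul_ne_zero (pow_ne_zero _ hc) hne')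
  intro c
  by_cases hc0 : c = 0
  · subst hc0
    exact eq_zero_of_forall_ne_zero (analyticOnNhd_eval_line P (M.pt w)).continuous hc
  · exact hc c hc0

/-- **Minimal primes of `𝔍(X)` are relevant.** [folklore] -/
theorem isRelevant_of_mem_minimalPrimes {X : Set V} {𝔮 : Ideal (MvPolynomial (Fin (N + 1)) ℂ)}
    (h𝔮 : 𝔮 ∈ (M.vanishing X).minimalPrimes) : M.IsRelevant 𝔮 := by
  classical
  by_contra hirr
  simp only [IsRelevant, not_exists, not_and, not_not] at hirr
  haveI := h𝔮.1.1
  have hfin := Ideal.finite_minimalPrimes_of_isNoetherianRing _ (M.vanishing X)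
  set others := hfin.toFinset.erase 𝔮 with hothers
  have hnot : ¬ (others.inf id ≤ 𝔮) := by
    rw [Ideal.IsPrime.inf_le' inferInstance]
    rintro ⟨𝔮', h𝔮', hle⟩
    rw [hothers, Finset.mem_erase, Set.Finite.mem_toFinset] at h𝔮'
    have : 𝔮' = 𝔮 := le_antisymm hle (h𝔮.2 ⟨h𝔮'.2.1.1, h𝔮'.2.1.2⟩ hle)
    exact h𝔮'.1 this
  obtain ⟨f, hf, hf𝔮⟩ := Set.not_subset.mp hnot
  have hfu : ∀ u ∈ M.bdry, f * u ∈ M.vanishing X := by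
    intro u hu
    rw [← (M.isRadical_vanishing X).radical, ← Ideal.sInf_minimalPrimes, Submodule.mem_sInf]
    intro 𝔮' h𝔮'
    by_cases heq : 𝔮' = 𝔮
    · rw [heq]; exact 𝔮.mul_mem_left _ (hirr u hu)
    · have hmem : 𝔮' ∈ others := by
        rw [hothers, Finset.mem_erase, Set.Finite.mem_toFinset]; exact ⟨heq, h𝔮'⟩
      exact Ideal.mul_mem_right _ 𝔮' ((Finset.inf_le (f := id) hmem) hf)
  exact hf𝔮 (h𝔮.1.2 (M.mem_vanishing_of_forall_mul_bdry hfu))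

/-- Minimal primes of `𝔍(X)` are homogeneous, above `𝔊`, and relevant; hence
`𝔍(Z_G(𝔮)) = 𝔮`. [folklore] -/
theorem vanishing_zeroSet_eq_of_mem_minimalPrimes {X : Set V}
    {𝔮 : Ideal (MvPolynomial (Fin (N + 1)) ℂ)} (h𝔮 : 𝔮 ∈ (M.vanishing X).minimalPrimes) :
    M.vanishing (M.zeroSet (𝔮 : Set (MvPolynomial (Fin (N + 1)) ℂ))) = 𝔮 := by
  haveI := h𝔮.1.1
  exact M.vanishing_zeroSet_eq_of_isPrime
    (Literature.RingTheory.MvPolynomial.isHomogeneous_of_mem_minimalPrimes (M.isHomogeneous_vanishing X) h𝔮)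
    ((M.relIdeal_le_vanishing X).trans h𝔮.1.2) (M.isRelevant_of_mem_minimalPrimes h𝔮)

/-- **Components.** For any `X`, the zero set of a minimal prime `𝔮` of `𝔍(X)` is an irreducible
closed set with vanishing ideal `𝔮`, contained in `Z_G(𝔍(X))`. [cite: NesterenkoPhilippon2001, Ch. 11 §2.1] -/
theorem isIrred_zeroSet_of_mem_minimalPrimes {X : Set V}
    {𝔮 : Ideal (MvPolynomial (Fin (N + 1)) ℂ)} (h𝔮 : 𝔮 ∈ (M.vanishing X).minimalPrimes) :
    M.IsIrred (M.zeroSet (𝔮 : Set (MvPolynomial (Fin (N + 1)) ℂ))) ∧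
      M.vanishing (M.zeroSet (𝔮 : Set (MvPolynomial (Fin (N + 1)) ℂ))) = 𝔮 ∧
      M.zeroSet (𝔮 : Set (MvPolynomial (Fin (N + 1)) ℂ)) ⊆ M.zeroSet (M.vanishing X) := by
  have hv := M.vanishing_zeroSet_eq_of_mem_minimalPrimes h𝔮
  refine ⟨⟨M.isClosedG_zeroSet _, ?_⟩, hv, M.zeroSet_antitone h𝔮.1.2⟩
  rw [hv]; exact h𝔮.1.1

/-- `Z_G` of a finite intersection of ideals is the union of the zero sets. [folklore] -/
theorem zeroSet_finset_inf {ι : Type*} (s : Finset ι) (I : ι → Ideal (MvPolynomial (Fin (N + 1)) ℂ)) :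
    M.zeroSet ((s.inf I : Ideal _) : Set (MvPolynomial (Fin (N + 1)) ℂ)) = ⋃ i ∈ s, M.zeroSet (I i) := by
  classical
  induction s using Finset.induction_on with
  | empty => rw [Finset.inf_empty, zeroSet_top]; simp
  | insert i s hi ih => rw [Finset.inf_insert, zeroSet_inf, ih, Finset.set_biUnion_insert]

/-- **A closed set is the (finite) union of its components.** [cite: NesterenkoPhilippon2001, Ch. 11 §2.1] -/
theorem IsClosedG.eq_biUnion_minimalPrimes {X : Set V} (hX : M.IsClosedG X) :
    X = ⋃ 𝔮 ∈ (Ideal.finite_minimalPrimes_of_isNoetherianRing _ (M.vanishing X)).toFinset,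
      M.zeroSet ((𝔮 : Ideal (MvPolynomial (Fin (N + 1)) ℂ)) : Set (MvPolynomial (Fin (N + 1)) ℂ)) := by
  have h := M.zeroSet_finset_inf
    (Ideal.finite_minimalPrimes_of_isNoetherianRing _ (M.vanishing X)).toFinset id
  simp only [id] at h
  rw [← h, Finset.inf_id_eq_sInf, Set.Finite.coe_toFinset, Ideal.sInf_minimalPrimes,
    (M.isRadical_vanishing X).radical, hX.eq]

/-- An irreducible closed subset of `X` lies in some component of `X`. [folklore] -/
theorem IsIrred.exists_minimalPrimes_subset {X Y : Set V} (hY : M.IsIrred Y) (hYX : Y ⊆ X) :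
    ∃ 𝔮 ∈ (M.vanishing X).minimalPrimes, Y ⊆ M.zeroSet ((𝔮 : Ideal _) : Set (MvPolynomial (Fin (N + 1)) ℂ)) := by
  haveI := hY.isPrime
  obtain ⟨𝔮, h𝔮, hle⟩ := Ideal.exists_minimalPrimes_le (M.vanishing_antitone hYX)
  refine ⟨𝔮, h𝔮, ?_⟩
  rw [← hY.isClosedG.eq]
  exact M.zeroSet_antitone hle

/-- Components contained in one another are equal. [folklore] -/
theorem eq_of_zeroSet_subset_of_mem_minimalPrimes {X : Set V}
    {𝔮 𝔮' : Ideal (MvPolynomial (Fin (N + 1)) ℂ)} (h𝔮 : 𝔮 ∈ (M.vanishing X).minimalPrimes)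
    (h𝔮' : 𝔮' ∈ (M.vanishing X).minimalPrimes)
    (h : M.zeroSet ((𝔮 : Ideal _) : Set (MvPolynomial (Fin (N + 1)) ℂ)) ⊆ M.zeroSet 𝔮') :
    𝔮 = 𝔮' := by
  have h1 := M.vanishing_zeroSet_eq_of_mem_minimalPrimes h𝔮
  have h2 := M.vanishing_zeroSet_eq_of_mem_minimalPrimes h𝔮'
  have hle : 𝔮' ≤ 𝔮 := by rw [← h1, ← h2]; exact M.vanishing_antitone h
  exact le_antisymm (h𝔮.2 ⟨h𝔮'.1.1, h𝔮'.1.2⟩ hle) hle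

/-- The vanishing ideal of an irreducible set `Y` is a minimal prime of `𝔍(X)` as soon as `Y` is a
maximal irreducible closed subset of the closed set `X`. [folklore] -/
theorem IsIrred.vanishing_mem_minimalPrimes {X Y : Set V} (hX : M.IsClosedG X) (hY : M.IsIrred Y)
    (hYX : Y ⊆ X) (hmax : ∀ Z, M.IsIrred Z → Y ⊆ Z → Z ⊆ X → Z = Y) :
    M.vanishing Y ∈ (M.vanishing X).minimalPrimes := by
  obtain ⟨𝔮, h𝔮, hY𝔮⟩ := hY.exists_minimalPrimes_subset M hYX
  obtain ⟨hirr, hv, hsub⟩ := M.isIrred_zeroSet_of_mem_minimalPrimes h𝔮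
  rw [hX.eq] at hsub
  have := hmax _ hirr hY𝔮 hsub
  rw [← this, hv]
  exact h𝔮

/-! ### Dimension -/

/-- **The dimension of the cone over `X ⊆ V`**: the Krull dimension of `ℂ[X₀,…,X_N] ⧸ 𝔍(X)`
(so `dim X + 1` for non-empty `X`; `0` for the empty set). [cite: NesterenkoPhilippon2001, Ch. 11 §2.2] -/
def coneDim (X : Set V) : ℕ :=
  ((ringKrullDim (MvPolynomial (Fin (N + 1)) ℂ ⧸ M.vanishing X)).unbotD 0).toNat

/-- For non-empty `X`, `coneDim X` is the Krull dimension of `R ⧸ 𝔍(X)`. [folklore] -/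
theorem coneDim_eq {X : Set V} (hX : X.Nonempty) :
    (M.coneDim X : WithBot ℕ∞) = ringKrullDim (MvPolynomial (Fin (N + 1)) ℂ ⧸ M.vanishing X) := by
  obtain ⟨d, hd, -⟩ := GaGm.exists_ringKrullDim_quotient_eq (M.vanishing_ne_top hX)
  rw [coneDim, hd]
  rfl

/-- `coneDim ∅ = 0`. [folklore] -/
@[simp] theorem coneDim_empty : M.coneDim (∅ : Set V) = 0 := by
  rw [coneDim, vanishing_empty]
  haveI : Subsingleton (MvPolynomial (Fin (N + 1)) ℂ ⧸ (⊤ : Ideal (MvPolynomial (Fin (N + 1)) ℂ))) :=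
    Ideal.Quotient.subsingleton_iff.mpr rfl
  rw [ringKrullDim_eq_bot_of_subsingleton]
  simp

/-- `coneDim X ≤ N + 1`. [folklore] -/
theorem coneDim_le (X : Set V) : M.coneDim X ≤ N + 1 := by
  by_cases hX : X.Nonempty
  · obtain ⟨d, hd, hdn⟩ := GaGm.exists_ringKrullDim_quotient_eq (M.vanishing_ne_top hX)
    rw [coneDim, hd]
    exact hdn
  · rw [Set.not_nonempty_iff_eq_empty] at hX
    rw [hX, coneDim_empty]
    exact Nat.zero_le _

/-- **A non-empty set has `coneDim ≥ 1`** (its ideal is not the irrelevant maximal ideal since some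
`Θ_J(w) ≠ 0`). [folklore] -/
theorem one_le_coneDim {X : Set V} (hX : X.Nonempty) : 1 ≤ M.coneDim X := by
  obtain ⟨w, hw⟩ := hX
  -- `𝔍(X) ≤ 𝔍({w})`, a prime strictly below the irrelevant ideal
  have h1 : M.vanishing X ≤ M.vanishing {w} := M.vanishing_antitone (singleton_subset_iff.mpr hw)
  haveI hprime : (M.vanishing {w}).IsPrime := by
    refine ⟨M.vanishing_ne_top ⟨w, rfl⟩, fun {P Q} hPQ => ?_⟩
    have hline : ∀ t : ℂ, eval (t • M.pt w) P * eval (t • M.pt w) Q = 0 := fun t => by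
      have := hPQ w rfl t
      rwa [map_mul] at this
    rcases eq_zero_or_eq_zero_of_mul_eq_zero (analyticOnNhd_eval_line P _)
      (analyticOnNhd_eval_line Q _) hline with h | h
    · exact Or.inl fun w' hw' c => by rw [Set.mem_singleton_iff.mp hw']; exact h c
    · exact Or.inr fun w' hw' c => by rw [Set.mem_singleton_iff.mp hw']; exact h c
  obtain ⟨J, hJ⟩ := M.exists_Θ_ne_zero w
  have hX1 : (MvPolynomial.X J : MvPolynomial (Fin (N + 1)) ℂ) ∉ M.vanishing {w} := fun h => by
    have := h w rfl 1
    rw [one_smul, eval_X] at this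
    exact hJ this
  -- chain `𝔍({w}) < 𝔪` where `𝔪 = (X₀, …, X_N)`
  have hlt : M.vanishing {w} < RingHom.ker (constantCoeff : MvPolynomial (Fin (N + 1)) ℂ →+* ℂ) := by
    refine lt_of_le_of_ne (Literature.RingTheory.MvPolynomial.le_ker_constantCoeff_of_isHomogeneous
      (M.isHomogeneous_vanishing _) (M.vanishing_ne_top ⟨w, rfl⟩)) fun h => hX1 ?_
    rw [h, RingHom.mem_ker, constantCoeff_X]
  have hmax := Literature.RingTheory.MvPolynomial.isMaximal_ker_constantCoeff (σ := Fin (N + 1)) (K := ℂ)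
  haveI := hmax.isPrime
  have hdim := Literature.RingTheory.MvPolynomial.one_le_ringKrullDim_quotient_of_lt hlt
  have h2 : ringKrullDim (MvPolynomial (Fin (N + 1)) ℂ ⧸ M.vanishing {w}) ≤
      ringKrullDim (MvPolynomial (Fin (N + 1)) ℂ ⧸ M.vanishing X) :=
    ringKrullDim_le_of_surjective (Ideal.Quotient.factor h1) (Ideal.Quotient.factor_surjective _)
  rw [← M.coneDim_eq ⟨w, hw⟩] at h2
  exact_mod_cast hdim.trans h2

/-- Dimension is monotone. [folklore] -/
theorem coneDim_mono {X Y : Set V} (hYX : Y ⊆ X) : M.coneDim Y ≤ M.coneDim X := by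
  by_cases hY : Y.Nonempty
  · have hX : X.Nonempty := hY.mono hYX
    have h := ringKrullDim_le_of_surjective
      (Ideal.Quotient.factor (M.vanishing_antitone hYX)) (Ideal.Quotient.factor_surjective _)
    rw [← M.coneDim_eq hX, ← M.coneDim_eq hY] at h
    exact_mod_cast h
  · rw [Set.not_nonempty_iff_eq_empty] at hY
    subst hY
    rw [coneDim_empty]; exact Nat.zero_le _

/-- `coneDim` only depends on the vanishing ideal: `coneDim Z_G(𝔍(X)) = coneDim X`. [folklore] -/
theorem coneDim_zeroSet_vanishing (X : Set V) : M.coneDim (M.zeroSet (M.vanishing X)) = M.coneDim X := by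
  rw [coneDim, coneDim, vanishing_zeroSet_vanishing]

/-- **A proper closed subset of an irreducible closed set has smaller dimension.**
[cite: NesterenkoPhilippon2001, Ch. 11 Thm. 4.1 (proof, (a))] -/
theorem coneDim_lt_of_ssubset {X Y : Set V} (hX : M.IsIrred X) (hY : M.IsClosedG Y) (hYne : Y.Nonempty)
    (hYX : Y ⊂ X) : M.coneDim Y < M.coneDim X := by
  have hle : M.vanishing X ≤ M.vanishing Y := M.vanishing_antitone hYX.subset
  have hne : M.vanishing X ≠ M.vanishing Y := by
    intro h
    apply hYX.ne
    rw [← hX.isClosedG.eq, ← hY.eq, h]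
  haveI := hX.isPrime
  haveI : IsDomain (MvPolynomial (Fin (N + 1)) ℂ ⧸ M.vanishing X) := Ideal.Quotient.isDomain _
  set J : Ideal (MvPolynomial (Fin (N + 1)) ℂ ⧸ M.vanishing X) :=
    (M.vanishing Y).map (Ideal.Quotient.mk (M.vanishing X)) with hJ
  have hJ0 : J ≠ ⊥ := by
    intro h0
    apply hne
    refine le_antisymm hle fun P hP => ?_
    have : Ideal.Quotient.mk (M.vanishing X) P ∈ J := Ideal.mem_map_of_mem _ hP
    rw [h0, Submodule.mem_bot, Ideal.Quotient.eq_zero_iff_mem] at this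
    exact this
  have h1 := Literature.RingTheory.KrullDimension.ringKrullDim_quotient_add_one_le hJ0
  have e := ringKrullDim_eq_of_ringEquiv (DoubleQuot.quotQuotEquivQuotOfLE hle)
  rw [e, ← M.coneDim_eq hYne, ← M.coneDim_eq hX.nonempty] at h1
  have : (M.coneDim Y : WithBot ℕ∞) + 1 = ((M.coneDim Y + 1 : ℕ) : WithBot ℕ∞) := by push_cast; rfl
  rw [this] at h1
  have h2 : M.coneDim Y + 1 ≤ M.coneDim X := by exact_mod_cast h1
  omega

/-- **The dimension of a closed set is attained on a component.** [folklore] -/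
theorem exists_minimalPrimes_coneDim_eq {X : Set V} (hX : X.Nonempty) :
    ∃ 𝔮 ∈ (M.vanishing X).minimalPrimes,
      M.coneDim (M.zeroSet ((𝔮 : Ideal _) : Set (MvPolynomial (Fin (N + 1)) ℂ))) = M.coneDim X := by
  obtain ⟨d, hd, -⟩ := GaGm.exists_ringKrullDim_quotient_eq (M.vanishing_ne_top hX)
  obtain ⟨𝔮, h𝔮, h𝔮d⟩ :=
    Literature.RingTheory.MvPolynomial.exists_minimalPrimes_ringKrullDim_quotient_eq hd
  refine ⟨𝔮, h𝔮, ?_⟩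
  have hne := (M.isIrred_zeroSet_of_mem_minimalPrimes h𝔮).1.nonempty
  have h1 := M.coneDim_eq hne
  rw [M.vanishing_zeroSet_eq_of_mem_minimalPrimes h𝔮, h𝔮d] at h1
  have h2 := M.coneDim_eq hX
  rw [hd] at h2
  have : (M.coneDim (M.zeroSet ((𝔮 : Ideal _) : Set (MvPolynomial (Fin (N + 1)) ℂ))) : WithBot ℕ∞) =
      M.coneDim X := by rw [h1, h2]
  exact_mod_cast this

/-- An irreducible closed subset of a closed `X` with `coneDim = coneDim X` is a component of `X`
(is the zero set of a minimal prime of `𝔍(X)`, with that prime as vanishing ideal). [folklore] -/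
theorem IsIrred.exists_eq_zeroSet_minimalPrimes {Y X : Set V} (hY : M.IsIrred Y) (hX : M.IsClosedG X)
    (hYX : Y ⊆ X) (hdim : M.coneDim Y = M.coneDim X) :
    ∃ 𝔮 ∈ (M.vanishing X).minimalPrimes,
      Y = M.zeroSet ((𝔮 : Ideal _) : Set (MvPolynomial (Fin (N + 1)) ℂ)) ∧ M.vanishing Y = 𝔮 := by
  obtain ⟨𝔮, h𝔮, hY𝔮⟩ := hY.exists_minimalPrimes_subset M hYX
  obtain ⟨hirr, hv, hsub⟩ := M.isIrred_zeroSet_of_mem_minimalPrimes h𝔮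
  rw [hX.eq] at hsub
  refine ⟨𝔮, h𝔮, ?_⟩
  by_cases heq : Y = M.zeroSet ((𝔮 : Ideal _) : Set (MvPolynomial (Fin (N + 1)) ℂ))
  · exact ⟨heq, by rw [heq, hv]⟩
  · exfalso
    have hlt := M.coneDim_lt_of_ssubset hirr hY.isClosedG hY.nonempty (ssubset_of_subset_of_ne hY𝔮 heq)
    have hle := M.coneDim_mono hsub
    omega

/-- An irreducible closed set inside a closed `X` of the same dimension, maximality form: every
irreducible closed `Z` with `Y ⊆ Z ⊆ X` equals `Y`. [folklore] -/
theorem IsIrred.eq_of_subset_of_coneDim_eq {Y Z : Set V} (hZ : M.IsIrred Z) (hY : M.IsClosedG Y)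
    (hYne : Y.Nonempty) (hYZ : Y ⊆ Z) (hdim : M.coneDim Z ≤ M.coneDim Y) : Y = Z := by
  by_contra hne
  have := M.coneDim_lt_of_ssubset hZ hY hYne (ssubset_of_subset_of_ne hYZ hne)
  omega

/-- The height of a prime of the polynomial ring is a natural number `≤ N + 1`. [folklore] -/
theorem exists_height_eq (𝔭 : Ideal (MvPolynomial (Fin (N + 1)) ℂ)) [𝔭.IsPrime] :
    ∃ m : ℕ, 𝔭.height = m ∧ m ≤ N + 1 := by
  have hle := Ideal.height_le_ringKrullDim_of_ne_top (Ideal.IsPrime.ne_top (inferInstance : 𝔭.IsPrime))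
  rw [GaGm.ringKrullDim_poly] at hle
  have hle' : 𝔭.height ≤ (N + 1 : ℕ) := by exact_mod_cast hle
  obtain ⟨m, hm⟩ := ENat.ne_top_iff_exists.1 (ne_top_of_le_ne_top (ENat.coe_ne_top _) hle')
  refine ⟨m, hm.symm, ?_⟩
  rw [← hm] at hle'
  exact_mod_cast hle'

/-- **The catenary bridge**: for a relevant homogeneous prime `𝔭 ⊇ 𝔊` of height `m`,
`coneDim Z_G(𝔭) + m = N + 1` (dimension formula for the polynomial ring).
[cite: Matsumura1987, Thm 5.6] -/
theorem coneDim_add_eq_of_height_eq {𝔭 : Ideal (MvPolynomial (Fin (N + 1)) ℂ)} [𝔭.IsPrime]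
    (hhom : 𝔭.IsHomogeneous (homogeneousSubmodule (Fin (N + 1)) ℂ)) (h𝔊 : M.relIdeal ≤ 𝔭)
    (hrel : M.IsRelevant 𝔭) {m : ℕ} (hm : 𝔭.height = m) :
    M.coneDim (M.zeroSet ((𝔭 : Ideal _) : Set (MvPolynomial (Fin (N + 1)) ℂ))) + m = N + 1 := by
  have h := Literature.RingTheory.KrullDimension.ringKrullDim_quotient_add_eq_of_height_eq ℂ m 𝔭 hm
  have hv := M.vanishing_zeroSet_eq_of_isPrime hhom h𝔊 hrel
  have hcd := M.coneDim_eq (M.zeroSet_nonempty_of_isRelevant hhom h𝔊 hrel)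
  rw [hv] at hcd
  rw [GaGm.ringKrullDim_poly, ← hcd] at h
  have : ((M.coneDim (M.zeroSet ((𝔭 : Ideal _) : Set (MvPolynomial (Fin (N + 1)) ℂ))) : ℕ) : WithBot ℕ∞) +
      (m : WithBot ℕ∞) = ((M.coneDim (M.zeroSet ((𝔭 : Ideal _) : Set (MvPolynomial (Fin (N + 1)) ℂ))) + m : ℕ) :
        WithBot ℕ∞) := by
    push_cast; rfl
  rw [this] at h
  exact_mod_cast h

end AnalyticGroupModel

end Literature.NumberTheory.Transcendental
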